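import Summits.HodgeConjecture.CorCM.CMAbelianFourfoldPowers
import Summits.HodgeConjecture.CorCM.SimpleCMSurfaceTimesThreefoldHodge
import Summits.HodgeConjecture.CorCM.MumfordTateRankOfCMAbelianVariety
import Summits.HodgeConjecture.CorCM.MumfordTateRankEllipticProducts
import HarnessLib

/-!
# Simple CM abelian SURFACE × simple CM abelian THREEFOLD: `dim MT(H¹(S × T)) = 6` — the Mumford–Tate rank of the dimension-`5`
# cell with two CM factors, read off seat b16's nondegeneracy theorem (Moonen–Zarhin 1999 Thm. (0.2) (4), CM case)

COR-CM (cell `pub-hodgecm2`, seat `b27` gen 49, count-neutral Mumford–Tate-rank ladder; theorems only, no definition, no named fact;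
UNCONDITIONAL — nothing here uses or asserts HC_CM).  Notation `t(X) = dim MT(H¹X)`.

Seat b16's `isNondegenerateFamily_simpleSurface_simpleThreefold` (`CorCM/SimpleCMSurfaceTimesThreefoldHodge`) says that a CM realisation
family with exactly two slots, a SIMPLE surface (quartic CM field) and a SIMPLE threefold (sextic CM field), is NONDEGENERATE — whatever the
fields (the Galois closure of a sextic CM field contains no cyclic or dihedral quartic CM field).  This file transports it to the variety
`X ∼ S × T` for ABSTRACT simple CM `S` (`dim 2`) and `T` (`dim 3`): Milne's regrouping of the CM variety `X`
(`exists_isIsogeny_biproduct_of_isSimple_of_isOfCMType`: `X ∼ ⨁_j A'_{cls j}` with simple, pairwise non-isogenous CM realisations `A'_c`)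
has, by uniqueness of simple isogeny factors (`exists_isIsogenous_of_isSimple_of_avDominatedBy_biproduct`: every `A'_c` is dominated by
`S × T`, hence isogenous to `S` or to `T`), exactly the two slots `c_S ∼ S`, `c_T ∼ T` with `[K:ℚ] = 4, 6`; nondegeneracy of the family of
representatives is `t(X) = dim S + dim T + 1` (`isNondegenerateFamily_iff_mtRank_hodge_one_eq`, Gordon 9.1 / Deligne I Ex. 3.7 (c)):

* **`mtRank_hodge_one_eq_six_of_isIsogenous_cmSurface_prod_cmThreefold`** — `t(X) = 6 = t(S) + t(T) − 1` (`Hg(S × T) = U_{F_S} × U_{F_T}`).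

With `CorCM/MumfordTateRankCMSurfaceTimesTypeIV` (`S_CM × T_IV(2,1) = 12`) and the semisimple rows this completes the dimension-`5` partition
`{2, 3}` (`CorCM/MumfordTateRankSurfaceTimesThreefold`).

## References
* [MoonenZarhin1999LowDim] B. Moonen, Yu. G. Zarhin, *Hodge classes on abelian varieties of low dimension*, Math. Ann. 315 (1999), Thm. (0.2) (4),
  (5.6) [corpus: paper:arxiv-math_9901113 pp. 1–2, 10]. [cite: MoonenZarhin1999LowDim, Thm. (0.2) (4)]
* [Gordon1999HodgeAVSurvey] B. B. Gordon, *A survey of the Hodge conjecture for abelian varieties*, 7.5–7.7, 9.1. [cite: Gordon1999HodgeAVSurvey, 7.5 and 9.1]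
* [MumfordAV1970] D. Mumford, *Abelian Varieties* (1970), §19 Thm. 1 and Cor. 1 (uniqueness of simple isogeny factors). [cite: MumfordAV1970, §19 Cor. 1 of Thm. 1]
* [Milne1999LefschetzClasses] J. S. Milne, Duke Math. J. 96 (1999), §1 Prop. 1.1 (regrouping). [cite: Milne1999LefschetzClasses, §1 Prop. 1.1]
-/

noncomputable section

open CategoryTheory CategoryTheory.Limits NumberField Module
open scoped BigOperators

namespace Summit.HodgeConjecture.CorCM

open Literature.NumberTheory.ComplexMultiplication
open Literature.AlgebraicGeometry.Motives
open Literature.AlgebraicGeometry.Motives.AbelianVariety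
open Literature.AlgebraicGeometry.HodgeTheory
open Literature.AlgebraicGeometry.ComplexMultiplication (IsCMTypeRealisation)
open Literature.AlgebraicGeometry.Milne1999
open Literature.AlgebraicGeometry.Pohlmann1968
open Summit.HodgeConjecture.CorCM.Domination

variable [HodgeTensorFacts.{0, 0}] {X : AbelianVariety ℂ} {n : ℕ}

/-- **Simple CM SURFACE × simple CM THREEFOLD: `t = 6`.**  For `X ∼ S × T` with `S` simple of CM type of dimension `2` and `T` simple of CM type of
dimension `3`: `dim MT(H¹X) = 6 = dim S + dim T + 1` (`Hg(X) = Hg(S) × Hg(T)`, both tori, of ranks `2` and `3`) — the family of the two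
representatives of Milne's regrouping of `X` is a simple-surface / simple-threefold pair, nondegenerate by seat b16's
`isNondegenerateFamily_simpleSurface_simpleThreefold`, and nondegeneracy is `t = rdim + 1` (`isNondegenerateFamily_iff_mtRank_hodge_one_eq`).
[cite: MoonenZarhin1999LowDim, Thm. (0.2) (4)] [cite: Gordon1999HodgeAVSurvey, 7.5 and 9.1] [cite: MumfordAV1970, §19 Cor. 1 of Thm. 1] -/
theorem mtRank_hodge_one_eq_six_of_isIsogenous_cmSurface_prod_cmThreefold (hX : IsSmoothProjective n X.X) {S T : AbelianVariety ℂ}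
    (hSs : S.IsSimple) (hS2 : S.dim = 2) (hScm : IsOfCMType S) (hTs : T.IsSimple) (hT3 : T.dim = 3) (hTcm : IsOfCMType T)
    (hXP : IsIsogenous X (S.prod T)) :
    haveI := BettiUniverse.finite hX 1
    (BettiUniverse.hodge exists_isReal_hodgeModel_holds hX 1).mtRank = 6 := by
  classical
  haveI := BettiUniverse.finite hX 1
  obtain ⟨g, hg⟩ := hXP
  have h0 : 0 < X.dim := by rw [dim_eq_of_isIsogeny hg, dim_prod]; omega
  have hcm : IsOfCMType X := (isOfCMType_iff_of_isIsogenous ⟨g, hg⟩).2 (isOfCMType_prod_iff.2 ⟨hScm, hTcm⟩)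
  -- Milne's regrouping with simple, pairwise non-isogenous representatives
  obtain ⟨C, _, K', _, _, _, Φ', A', ι', θ', m, cls, f, hA, hs, hniso, hcls, hf⟩ :=
    exists_isIsogeny_biproduct_of_isSimple_of_isOfCMType h0 hcm
  -- `S × T ∼ ⨁ ![S, T]`, and every representative is dominated by it
  obtain ⟨g₂, hg₂⟩ := prod_isIsogenous_biproduct_two S T
  have hF : ∀ j : Fin 2, ((![S, T] : Fin 2 → AbelianVariety ℂ) j).IsSimple := fun j => by
    fin_cases j
    · exact hSs
    · exact hTs
  have hdom : ∀ c, AVDominatedBy (A' c) (⨁ fun j : Fin 2 => (![S, T] : Fin 2 → AbelianVariety ℂ) j) := by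
    intro c
    obtain ⟨j, rfl⟩ := hcls c
    exact ((((avDominatedBy_biproduct_summand (fun i => A' (cls i)) j).trans_isIsogeny_inv hf).trans_isIsogeny_hom hg)
      ).trans_isIsogeny_hom hg₂
  have hdimpos : ∀ c, 0 < (A' c).dim := fun c => by
    have h := finrank_eq_two_mul_dim_of_isCMTypeRealisation (hA c)
    have hpos : 0 < finrank ℚ (K' c) := Module.finrank_pos
    omega
  have hrep : ∀ c, IsIsogenous (A' c) S ∨ IsIsogenous (A' c) T := fun c => by
    obtain ⟨j, hj⟩ := exists_isIsogenous_of_isSimple_of_avDominatedBy_biproduct hF (hs c) (hdimpos c) (hdom c)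
    fin_cases j
    · exact Or.inl hj
    · exact Or.inr hj
  -- the slots of `S` and of `T`
  have hSX : AVDominatedBy S X := (SliceExhaustion.avDominatedBy_prod_left S T).trans_isIsogeny_inv hg
  have hTX : AVDominatedBy T X := (avDominatedBy_prod_right S T).trans_isIsogeny_inv hg
  obtain ⟨j₀, hj₀⟩ := exists_isIsogenous_of_isSimple_of_avDominatedBy_biproduct (fun j => hs (cls j)) hSs (by omega)
    (hSX.trans_isIsogeny_hom hf)
  obtain ⟨j₁, hj₁⟩ := exists_isIsogenous_of_isSimple_of_avDominatedBy_biproduct (fun j => hs (cls j)) hTs (by omega)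
    (hTX.trans_isIsogeny_hom hf)
  set c₀ := cls j₀ with hc₀
  set c₁ := cls j₁ with hc₁
  have hd₀ : (A' c₀).dim = 2 := by
    obtain ⟨u, hu⟩ := hj₀
    rw [← hS2, dim_eq_of_isIsogeny hu]
  have hd₁ : (A' c₁).dim = 3 := by
    obtain ⟨u, hu⟩ := hj₁
    rw [← hT3, dim_eq_of_isIsogeny hu]
  have h01 : c₀ ≠ c₁ := fun h => by
    have h' := hd₀
    rw [h, hd₁] at h'
    omega
  have hI : ∀ c, c = c₀ ∨ c = c₁ := by
    intro c
    rcases hrep c with hcS | hcT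
    · left
      by_contra hne
      exact hniso c c₀ hne (hcS.trans hj₀)
    · right
      by_contra hne
      exact hniso c c₁ hne (hcT.trans hj₁)
  -- degrees of the fields
  have h4 : finrank ℚ (K' c₀) = 4 := by rw [finrank_eq_two_mul_dim_of_isCMTypeRealisation (hA c₀), hd₀]
  have h6 : finrank ℚ (K' c₁) = 6 := by rw [finrank_eq_two_mul_dim_of_isCMTypeRealisation (hA c₁), hd₁]
  haveI : Nonempty C := ⟨c₀⟩
  have hnd : CMAlgebra.IsNondegenerateFamily Φ' :=
    isNondegenerateFamily_simpleSurface_simpleThreefold h01 hI h4 h6 hA (hs c₀) (hs c₁)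
  have ht := (isNondegenerateFamily_iff_mtRank_hodge_one_eq hA hcls hX ⟨f, hf⟩).1 hnd
  -- `Σ_c dim A'_c = 2 + 3`
  have huniv : (Finset.univ : Finset C) = {c₀, c₁} := by
    ext c
    simp only [Finset.mem_univ, Finset.mem_insert, Finset.mem_singleton, true_iff]
    exact hI c
  rw [ht, huniv, Finset.sum_pair h01, hd₀, hd₁]

end Summit.HodgeConjecture.CorCM

end
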